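import Summits.QuantumFields.BalabanUV.Beta.GAN24.MinimiserOneStepDecay
import Summits.QuantumFields.BalabanUV.Beta.GAN24.ScalarSupLettersCubicHolds

/-!
# G-an2-4 ∕ (CONV-C), road P2 — THE SOFT MINIMISER'S ONE-STEP LAW AND THE UNIT-LATTICE ONE-STEP KERNEL `S_{RN} − S_N` IN THE ROW'S KERNEL
# CURRENCY ON CUBIC UNIT TORI, UNCONDITIONAL: the four fine-lattice letters of `MinimiserOneStepDecay` §1–§2 DISCHARGED by the swarm's
# (SCALAR-LETTERS-LOC) export `ScalarSupLettersCubicHolds.scalarRowDecay_cubic`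

G-an2-4 formalisation swarm `b2b-balaban-gan24-formalise-*`, leaf prover 06 (gen 36), crux team (2) under the coordinator ruling «YM REDIRECT»
(e34b3e0c; FREEZE (0) honoured — a `GAN24/` junction importing EXISTING modules only).  The road-P2 owner `b2b-balaban-gan24-p2` (gen 29)
typed the one-step laws of the scalar soft ∕ hard minimisers and of the unit-lattice operator `S_n = a′Q′G′_nQ′*` in the row's KERNEL
currency (`MinimiserOneStepDecay`, p257333: rate `η`-type factor `(R−1)∕(RN)` in front AND exponential decay in the unit-lattice distance —
the «two clauses» `OpClose` shape of `GAN24/DirichletExhaustion`), CONDITIONAL on five fine-lattice letters in `RowDecay` form (`B₁ B₂ C₁ C₂`,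
`C₀`) and two unit-lattice letters (`S_N⁻¹`, `S_{RN}⁻¹`).  His «INTERFACE REQUEST G-an2-4: (SCALAR-LETTERS-LOC)» (HOME/INBOX 2026-08-21T09:07Z)
asked for the four letters in localised per-block row form «for the kernel-currency ENDs of `MinimiserOneStepDecay` … UNCONDITIONAL on landing».
The four letters `B₁ B₂ C₁ C₂` of §1 (soft law) and §2 (the kernel `S′ − S`) are TREE THEOREMS on cubic tori `fun _ : Fin (d+1) ⇒ N₀`, constants
functions of `(d, a′)` only, uniform in `N, R, N₀`: this lineage's `ScalarSupLettersCubicHolds.scalarRowDecay_cubic` (gen 35, p259462; the (α) chain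
+ leaf-01's (L0) `ScalarSup110G` + leaf-03's free heat-kernel inputs + leaf-04's `ScalarSupReductions`), read with `B₁ = Cst·(1 + log(RN))`,
`B₂ = C₁ = Cst`, `C₂ = Cst·(1 + log N)`.  (§3, the HARD law, needs in addition `C₀` = `ScalarZerothLetterTorus.rowDecay_Gps` and leaf-03 gen 49's
unit-lattice letters `SavgInverseUniform.rowDecay_Savg_inv_of_le`; its cubic junction is leaf-03 gen 49's `GAN24/HardMinimiserOneStepCubic` — journal
SPLIT 2026-08-21T10:16Z, one tree copy each.)
THIS FILE is the junction for §1–§2, BY NAME (`obtain` + `mono` + `ring`, no new estimate):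
 * §1 **`fieldDecay_Msoft_succ_sub_stair_cubic`** — THE SOFT LAW WITH DECAY, UNCONDITIONAL: `∃ δ > 0, ∀ δ′ ∈ (0, δ], ∃ C > 0, ∀ N R N₀ ≥ 1`, every
   unit-lattice source `v` with `|v(z)| ≤ V·e^{−δ′|z − y′|_{T,∞}}` has `|(M′v)(x′) − (J·Mv)(x′)| ≤ C·((R−1)∕(RN))·(2 + log(RN) + log N)·V·e^{−(δ′/4)|blk x′ − y′|}`;
   **`norm_Msoft_succ_sub_stair_apply_le_cubic`** — its kernel reading: `|(M′ − J·M)(x′, y′)| ≤ C·((R−1)∕(RN))·(2 + log(RN) + log N)·e^{−δ|blk x′ − y′|}`;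
 * §2 **`norm_Savg_succ_sub_apply_le_cubic`** — THE UNIT-LATTICE ONE-STEP KERNEL, UNCONDITIONAL:
   `|(S_{RN} − S_N)(y, y′)| ≤ C·((R−1)∕(RN))·(2 + log(RN) + log N)·e^{−δ|y − y′|_{T,∞}}` — the `OpClose` ∕ (CONV-C)-pair SHAPE (rate AND decay) for
   the scalar unit-lattice operator `S_n = a′Q′G′_nQ′*` of `HardMinimiserOneStepSup`, every `N, R, N₀ ≥ 1`, every `a′ > 0`;
READING (the tower `N = L^k`, `R = L`): `((R−1)∕(RN))·(2 + log(RN) + log N) ≤ (2 + (2k+1)·log L)·L^{−k}` — summable in `k`; with the decay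
factor this is the two-clause shape `|𝒦^{(k+1)} − 𝒦^{(k)}|(y,y′) ≤ C₄θ^k e^{−δ₄|y−y′|}` (any `θ ∈ (L⁻¹, 1)`) FOR THE SCALAR PROTOTYPE's `S_n` and soft leg.
HONEST SCOPE.  [folklore] junction of tree theorems BY NAME; scalar (0-form) `U = 1` prototype on CUBIC unit tori in dimension `d + 1`; constants
and rates EXISTENTIAL in size (functions of `(d, a′)`; the rate is the (α) chain's `δ` through leaf-04's resummation, quartered); the `(1 + log n)` letters are
OURS (Bałaban prints the VECTOR (1.110)∕(1.112)∕(1.115), [B5] pp. 35–36, and [B9] (3.42) at general `U` — text locations only, no quotation, no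
`[cite:]` claim); NOT (CONV-C) as typed (that is a statement about Bałaban's constituents `(G_k, H_k, C^{(k)})` with their inputs discharged), NEVER
«G-an2-4 closed», NOT NE2 ∕ NE3, NOT D1, NOT BetaPertH, NOT continuum, NOT Clay; 0 def, 0 `def … : Prop`, 0 cite, 0 sorry — not in print, our
bookkeeping.  HONEST DEPENDENCY: continuum YM on T⁴ ⇐ BetaPertH ∧ nine spine estimates (0/9 proved); BetaPertH ⇐ (D1) ∧ (D4) ∧ CAP+tail;
G-an2-4 gates asym, D1 and NE2/3/4.
-/

noncomputable section

open scoped BigOperators ComplexConjugate Matrix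

namespace Summit.QuantumFields.BalabanUV.Beta.GAN24.MinimiserOneStepDecayCubic

open Literature.MathematicalPhysics.QuantumFieldTheory.Balaban1983to89
open B5Prop11Plancherel (Tor fine)
open B5Action121 (sdiff)
open B5Blocks16 (blockOf)
open B6LowerBound2153Torus (rep)
open B4TorusKernel.MultiPeriod (torusSupNorm)
open B4Sect5Proof (latticeConst latticeConst_nonneg)
open Summit.QuantumFields.BalabanUV.T4Continuum.ScalarAveragedPropagator (Gps)
open Summit.QuantumFields.BalabanUV.Beta.GAN24.StaircaseLaplacianDefect (stair)
open Summit.QuantumFields.BalabanUV.Beta.GAN24.SoftMinimiserOneStepSup (Msoft)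
open Summit.QuantumFields.BalabanUV.Beta.GAN24.HardMinimiserOneStepSup (Savg)
open Summit.QuantumFields.BalabanUV.Beta.GAN24.BlockFieldDecay (RowDecay FieldDecay)
open Summit.QuantumFields.BalabanUV.Beta.GAN24.MinimiserOneStepDecay
  (epsSoft fieldDecay_Msoft_succ_sub_stair norm_Savg_succ_sub_apply_le fieldDecay_single)
open Summit.QuantumFields.BalabanUV.Beta.GAN24.Entry112SupLogCubic (latticeConst_succ_pos)
open Summit.QuantumFields.BalabanUV.Beta.GAN24.ScalarSupLettersCubicHolds (scalarRowDecay_cubic)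

variable (d : ℕ)

/-! ## §1 The soft law with decay, unconditional on cubic tori -/

/-- **THE SOFT LAW WITH DECAY ON CUBIC TORI, UNCONDITIONAL.**  For every `a′ > 0` there is a rate `δ > 0` (a function of `d, a′`) such that for
every source rate `0 < δ′ ≤ δ` there is `C > 0` (a function of `d, a′, δ′`) with: for all `N, R, N₀ ≥ 1`, every unit-lattice source `v` with
`|v(z)| ≤ V·e^{−δ′|z − y′|_{T,∞}}` (this forces `V ≥ 0`; no separate hypothesis) and every fine site `x′`,
`|(M′v)(x′) − (J·Mv)(x′)| ≤ C·((R−1)∕(RN))·(2 + log(RN) + log N)·V·e^{−(δ′/4)·|blockOf x′ − y′|_{T,∞}}`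
(`M = Msoft N _ a′`, `M′ = Msoft (R·N) _ a′`, `J = stair N R _`). [folklore] -/
theorem fieldDecay_Msoft_succ_sub_stair_cubic {a' : ℝ} (ha' : 0 < a') :
    ∃ δ : ℝ, 0 < δ ∧ ∀ δ' : ℝ, 0 < δ' → δ' ≤ δ → ∃ C : ℝ, 0 < C ∧
      ∀ (N R N₀ : ℕ) [NeZero N] [NeZero R] [NeZero N₀] (V : ℝ) (v : Tor (fun _ : Fin (d + 1) => N₀) → ℂ)
        (y' : Tor (fun _ : Fin (d + 1) => N₀)), FieldDecay (fun _ : Fin (d + 1) => N₀) id v V δ' y' →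
        FieldDecay (fun _ : Fin (d + 1) => N₀) (blockOf (R * N) (fun _ : Fin (d + 1) => N₀))
          (Msoft (R * N) (fun _ : Fin (d + 1) => N₀) a' *ᵥ v
            - stair N R (fun _ : Fin (d + 1) => N₀) *ᵥ (Msoft N (fun _ : Fin (d + 1) => N₀) a' *ᵥ v))
          (C * (((R : ℝ) - 1) / ((R : ℝ) * N)) * (2 + Real.log ((R * N : ℕ) : ℝ) + Real.log (N : ℝ)) * V) (δ' / 4) y' := by
  obtain ⟨Cst, δ, hCst, hδ, h⟩ := scalarRowDecay_cubic d ha'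
  refine ⟨δ, hδ, fun δ' hδ' hδ'δ => ?_⟩
  refine ⟨((d : ℝ) + 1) * a' * Cst ^ 2 * latticeConst (d + 1) (δ' / 2) * latticeConst (d + 1) (δ' / 4), ?_, ?_⟩
  · have hK2 : 0 < latticeConst (d + 1) (δ' / 2) := latticeConst_succ_pos (d := d) (by linarith)
    have hK4 : 0 < latticeConst (d + 1) (δ' / 4) := latticeConst_succ_pos (d := d) (by linarith)
    positivity
  intro N R N₀ _ _ _ V v y' hv
  have hV : 0 ≤ V := hv.nonneg
  have hN : 1 ≤ N := Nat.one_le_iff_ne_zero.mpr (NeZero.ne N)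
  have hRN : 1 ≤ R * N := Nat.one_le_iff_ne_zero.mpr (NeZero.ne (R * N))
  have key := fieldDecay_Msoft_succ_sub_stair N R (fun _ : Fin (d + 1) => N₀) ha' hδ' hδ'δ
    (B₁ := Cst * (1 + Real.log ((R * N : ℕ) : ℝ))) (B₂ := Cst) (C₁ := Cst) (C₂ := Cst * (1 + Real.log (N : ℝ)))
    (fun μ x y'' => (h (R * N) N₀ hRN μ μ x y'').2.1)
    (fun μ x y'' => (h (R * N) N₀ hRN μ μ x y'').1)
    (fun μ x y'' => (h N N₀ hN μ μ x y'').2.2.1)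
    (fun μ x y'' => (h N N₀ hN μ μ x y'').2.2.2)
    hV hv
  have e : epsSoft d N R a' (Cst * (1 + Real.log ((R * N : ℕ) : ℝ))) Cst Cst (Cst * (1 + Real.log (N : ℝ))) δ' * V
      = ((d : ℝ) + 1) * a' * Cst ^ 2 * latticeConst (d + 1) (δ' / 2) * latticeConst (d + 1) (δ' / 4)
          * (((R : ℝ) - 1) / ((R : ℝ) * N)) * (2 + Real.log ((R * N : ℕ) : ℝ) + Real.log (N : ℝ)) * V := by
    unfold epsSoft; ring
  exact key.mono e.le (by rw [← e]; exact key.nonneg) le_rfl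

/-- **THE SOFT MINIMISER'S ONE-STEP KERNEL ON CUBIC TORI, UNCONDITIONAL**: `∃ C δ > 0` (functions of `d, a′`) with, for all `N, R, N₀ ≥ 1`, every
fine site `x′` and unit site `y′`, `|(M′ − J·M)(x′, y′)| ≤ C·((R−1)∕(RN))·(2 + log(RN) + log N)·e^{−δ·|blockOf x′ − y′|_{T,∞}}`. [folklore] -/
theorem norm_Msoft_succ_sub_stair_apply_le_cubic {a' : ℝ} (ha' : 0 < a') :
    ∃ C δ : ℝ, 0 < C ∧ 0 < δ ∧ ∀ (N R N₀ : ℕ) [NeZero N] [NeZero R] [NeZero N₀]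
      (x' : Tor (fine (R * N) (fun _ : Fin (d + 1) => N₀))) (y' : Tor (fun _ : Fin (d + 1) => N₀)),
        ‖(Msoft (R * N) (fun _ : Fin (d + 1) => N₀) a'
            - stair N R (fun _ : Fin (d + 1) => N₀) * Msoft N (fun _ : Fin (d + 1) => N₀) a') x' y'‖
          ≤ C * (((R : ℝ) - 1) / ((R : ℝ) * N)) * (2 + Real.log ((R * N : ℕ) : ℝ) + Real.log (N : ℝ))
              * Real.exp (-(δ * torusSupNorm (fun _ : Fin (d + 1) => N₀)
                  (rep (fun _ : Fin (d + 1) => N₀) (blockOf (R * N) (fun _ : Fin (d + 1) => N₀) x')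
                    - rep (fun _ : Fin (d + 1) => N₀) y'))) := by
  obtain ⟨δ, hδ, hall⟩ := fieldDecay_Msoft_succ_sub_stair_cubic d ha'
  obtain ⟨C, hC, h⟩ := hall δ hδ le_rfl
  refine ⟨C, δ / 4, hC, by linarith, fun N R N₀ _ _ _ x' y' => ?_⟩
  have key := h N R N₀ 1 (Pi.single y' (1 : ℂ)) y' (fieldDecay_single (M := fun _ : Fin (d + 1) => N₀) δ y') x'
  rw [mul_one, Matrix.mulVec_mulVec, ← Matrix.sub_mulVec, Matrix.mulVec_single_one, Matrix.col_apply] at key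
  exact key

/-! ## §2 The unit-lattice one-step kernel `S_{RN} − S_N`, unconditional on cubic tori -/

/-- **THE UNIT-LATTICE ONE-STEP KERNEL DECAYS, WITH THE RATE IN FRONT — UNCONDITIONAL ON CUBIC TORI.**  For the scalar unit-lattice operator
`S_n = a′Q′G′_nQ′*` (`HardMinimiserOneStepSup.Savg`): `∃ C δ > 0` (functions of `d, a′`) such that for all `N, R, N₀ ≥ 1` and all unit sites
`y, y′` of the cubic torus `Π_μ ℤ/N₀`,
`|(S_{RN} − S_N)(y, y′)| ≤ C·((R−1)∕(RN))·(2 + log(RN) + log N)·e^{−δ·|y − y′|_{T,∞}}` — the `OpClose` two-clause shape. [folklore] -/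
theorem norm_Savg_succ_sub_apply_le_cubic {a' : ℝ} (ha' : 0 < a') :
    ∃ C δ : ℝ, 0 < C ∧ 0 < δ ∧ ∀ (N R N₀ : ℕ) [NeZero N] [NeZero R] [NeZero N₀] (y y' : Tor (fun _ : Fin (d + 1) => N₀)),
      ‖(Savg (R * N) (fun _ : Fin (d + 1) => N₀) a' - Savg N (fun _ : Fin (d + 1) => N₀) a') y y'‖
        ≤ C * (((R : ℝ) - 1) / ((R : ℝ) * N)) * (2 + Real.log ((R * N : ℕ) : ℝ) + Real.log (N : ℝ))
            * Real.exp (-(δ * torusSupNorm (fun _ : Fin (d + 1) => N₀)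
                (rep (fun _ : Fin (d + 1) => N₀) y - rep (fun _ : Fin (d + 1) => N₀) y'))) := by
  obtain ⟨Cst, δ, hCst, hδ, h⟩ := scalarRowDecay_cubic d ha'
  have hK2 : 0 < latticeConst (d + 1) (δ / 2) := latticeConst_succ_pos (d := d) (by linarith)
  have hK4 : 0 < latticeConst (d + 1) (δ / 4) := latticeConst_succ_pos (d := d) (by linarith)
  refine ⟨((d : ℝ) + 1) * a' * Cst ^ 2 * latticeConst (d + 1) (δ / 2) * latticeConst (d + 1) (δ / 4), δ / 4,
    by positivity, by linarith, fun N R N₀ _ _ _ y y' => ?_⟩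
  have hN : 1 ≤ N := Nat.one_le_iff_ne_zero.mpr (NeZero.ne N)
  have hRN : 1 ≤ R * N := Nat.one_le_iff_ne_zero.mpr (NeZero.ne (R * N))
  have key := norm_Savg_succ_sub_apply_le N R (fun _ : Fin (d + 1) => N₀) ha' hδ
    (B₁ := Cst * (1 + Real.log ((R * N : ℕ) : ℝ))) (B₂ := Cst) (C₁ := Cst) (C₂ := Cst * (1 + Real.log (N : ℝ)))
    (fun μ x y'' => (h (R * N) N₀ hRN μ μ x y'').2.1)
    (fun μ x y'' => (h (R * N) N₀ hRN μ μ x y'').1)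
    (fun μ x y'' => (h N N₀ hN μ μ x y'').2.2.1)
    (fun μ x y'' => (h N N₀ hN μ μ x y'').2.2.2)
    y y'
  calc _ ≤ _ := key
    _ = _ := by unfold epsSoft; ring

end Summit.QuantumFields.BalabanUV.Beta.GAN24.MinimiserOneStepDecayCubic

end
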